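import Summits.ValiantsHypothesis.ValiantsHypothesis.Theorems.SymPencilPerFourHessianToric

/-!
# Route `SymPencil` — the toric case at dimension `6`, I: the pair lever and perm-orthogonality
# tools (`--supports` stmt-ValiantsHypothesis-5674 `SdcSuperquadratic`; towards `R6` / `H106`,
# crux workfile `Cruxes/SdcSuperquadratic/TORIC-SIX.md`)

Let `W` be a subspace of `4 × 4` matrices on which all `3 × 3` subpermanents vanish (H3).

* `pair_lever` — the PAIR LEVER: if `x, y ∈ W` and row `r` of `x` vanishes, then for rows
  `p, p' ≠ r` and every column triple the `3 × 3` permanent of the rows `(x_p, x_{p'}, y_r)`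
  vanishes (the `ε`-linear term of H3 at `x + ε y`, characteristic `0`).  In matrix form:
  `P(x) · u = 0` for every row value `u = y_r`, where `P(x)_{jk} = per₂(x; p p'; {j,k}ᶜ)`.
* `perms_vanish_of_lever_three` — if the lever holds for all `u` in a subspace `M ⊆ K⁴` with
  `dim M ≥ 3` then ALL six `2 × 2` subpermanents of the rows `p, p'` of `x` vanish
  (`M ∩ span{e_j, e_k} ≠ 0` and the zero diagonal of `P(x)`).
* `perms_vanish_of_lever_pair` — if the lever holds for `u = e_a, e_b` then every `2 × 2`
  subpermanent of rows `p, p'` other than the one on columns `{a, b}` vanishes.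
* `support_pair_of_perm_orth` — two non-zero perm-orthogonal vectors of `K⁴` have a common
  support of size `≤ 2` (and agree there up to a sign twist).
* `subset_pair_of_bilinear_perm_orth` / `eq_zero_of_bilinear_perm_orth` — if `x_k y_l + x_l y_k
  = 0` for all `x ∈ A`, `y ∈ B` and all pairs `{k,l} ≠ {a,b}` (resp. all pairs) and `dim B ≥ 2`,
  then `A ⊆ K^{ab}` (resp. `A = 0`).
* `mem_of_le_pair_of_finrank` — a `2`-dimensional subspace of `K^{ab}` is `K^{ab}`.

Honest framing: linear-algebra lemmas for the toric case (all row and column ranks `≤ 2`) of the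
`6`-dimensional residual `R6`; nothing here changes `sdc(per_4) ≥ 25`; the crux `SdcSuperquadratic`
and `VP ≠ VNP` are untouched.  No definitions, no named facts. [folklore]
-/

noncomputable section

-- single-conjunct layout: Sub = Summit, duplicated namespace component intended
set_option linter.dupNamespace false

namespace Summit.ValiantsHypothesis.ValiantsHypothesis.Theorems.SymPencilPerFourToricLever

open Matrix MvPolynomial Finset Module
open Literature.Computability.AlgebraicComplexity
open Summit.ValiantsHypothesis.ValiantsHypothesis.Theorems.SymPencilPerFourHessianRankThreeZero
open Summit.ValiantsHypothesis.ValiantsHypothesis.Theorems.SymPencilPerFourHessianToric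

variable {K : Type*} [Field K]

/-! ### The pair lever -/

/-- **Pair lever.**  H3 at `x + t y` for `x, y ∈ W` with row `r` of `x` zero: the `t`-linear term
is the `3 × 3` permanent of `(x_p, x_{p'}, y_r)`, which therefore vanishes. [folklore] -/
theorem pair_lever [CharZero K] (W : Submodule K (Fin 4 × Fin 4 → K))
    (hW3 : ∀ x ∈ W, ∀ (r c : Fin 3 → Fin 4), Function.Injective r → Function.Injective c →
      ((Matrix.of fun i j => x (i, j)).submatrix r c).permanent = 0)
    {x y : Fin 4 × Fin 4 → K} (hx : x ∈ W) (hy : y ∈ W) {p p' r : Fin 4} (hpp' : p ≠ p')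
    (hpr : p ≠ r) (hp'r : p' ≠ r) (hxr : ∀ j, x (r, j) = 0) {j₀ j₁ j₂ : Fin 4} (h01 : j₀ ≠ j₁)
    (h02 : j₀ ≠ j₂) (h12 : j₁ ≠ j₂) :
    y (r, j₀) * (x (p, j₁) * x (p', j₂) + x (p, j₂) * x (p', j₁)) +
      y (r, j₁) * (x (p, j₀) * x (p', j₂) + x (p, j₂) * x (p', j₀)) +
      y (r, j₂) * (x (p, j₀) * x (p', j₁) + x (p, j₁) * x (p', j₀)) = 0 := by
  have hinjr : Function.Injective ![r, p, p'] := injective_vec_three hpr.symm hp'r.symm hpp'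
  have hinjc : Function.Injective ![j₀, j₁, j₂] := injective_vec_three h01 h02 h12
  have P : ∀ t : K,
      ((Matrix.of fun i j => (x + t • y) (i, j)).submatrix ![r, p, p'] ![j₀, j₁, j₂]).permanent
        = 0 := fun t => hW3 (x + t • y) (W.add_mem hx (W.smul_mem t hy)) _ _ hinjr hinjc
  have h1 := P 1
  have h2 := P (-1)
  have h3 := P 2
  rw [Matrix.permanent_fin_three_row] at h1 h2 h3
  simp only [Matrix.submatrix_apply, Matrix.of_apply, Matrix.cons_val_zero, Matrix.cons_val_one,
    Matrix.cons_val, Pi.add_apply, Pi.smul_apply, smul_eq_mul, hxr, zero_add] at h1 h2 h3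
  have h6 : (6 : K) * (y (r, j₀) * (x (p, j₁) * x (p', j₂) + x (p, j₂) * x (p', j₁)) +
      y (r, j₁) * (x (p, j₀) * x (p', j₂) + x (p, j₂) * x (p', j₀)) +
      y (r, j₂) * (x (p, j₀) * x (p', j₁) + x (p, j₁) * x (p', j₀))) = 0 := by
    linear_combination 6 * h1 - 2 * h2 - h3
  exact (mul_eq_zero.1 h6).resolve_left (by norm_num)

/-! ### Kernel lemmas for the matrix of `2 × 2` subpermanents -/

/-- **A `3`-dimensional kernel kills all subpermanents.**  If the lever identity holds for all
`u` in a subspace `M ⊆ K⁴` of dimension `≥ 3`, then all six `2 × 2` subpermanents of the rows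
`p, p'` of `x` vanish. [folklore] -/
theorem perms_vanish_of_lever_three (M : Submodule K (Fin 4 → K)) (hM : 3 ≤ finrank K M)
    (x : Fin 4 × Fin 4 → K) (p p' : Fin 4)
    (hlev : ∀ u ∈ M, ∀ j₀ j₁ j₂ : Fin 4, j₀ ≠ j₁ → j₀ ≠ j₂ → j₁ ≠ j₂ →
      u j₀ * (x (p, j₁) * x (p', j₂) + x (p, j₂) * x (p', j₁)) +
        u j₁ * (x (p, j₀) * x (p', j₂) + x (p, j₂) * x (p', j₀)) +
        u j₂ * (x (p, j₀) * x (p', j₁) + x (p, j₁) * x (p', j₀)) = 0) :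
    ∀ l l' : Fin 4, l ≠ l' → x (p, l) * x (p', l') + x (p, l') * x (p', l) = 0 := by
  classical
  intro l l' hll'
  obtain ⟨j, k, hjk, hjl, hjl', hkl, hkl', hall⟩ := exists_other_two l l' hll'
  -- `S = span {e_j, e_k}` meets `M`
  set S : Submodule K (Fin 4 → K) :=
    Submodule.span K (Set.range ![(Pi.single j (1 : K) : Fin 4 → K), Pi.single k 1]) with hS
  have hli : LinearIndependent K ![(Pi.single j (1 : K) : Fin 4 → K), Pi.single k 1] := by
    have h := (Pi.basisFun K (Fin 4)).linearIndependent
    have h' : LinearIndependent K (⇑(Pi.basisFun K (Fin 4)) ∘ ![j, k]) :=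
      h.comp _ (by intro a b hab; fin_cases a <;> fin_cases b <;> simp_all)
    convert h' using 1
    ext i : 1
    fin_cases i <;> simp
  have hS2 : finrank K S = 2 := by
    rw [hS, finrank_span_eq_card hli, Fintype.card_fin]
  have hsup : finrank K ↥(M ⊔ S) ≤ 4 := by
    have := Submodule.finrank_le (M ⊔ S)
    rwa [Module.finrank_fintype_fun_eq_card, Fintype.card_fin] at this
  have hinf : 1 ≤ finrank K ↥(M ⊓ S) := by
    have := Submodule.finrank_sup_add_finrank_inf_eq M S
    omega
  obtain ⟨⟨u, hu⟩, hu0⟩ := (Module.finrank_pos_iff_exists_ne_zero (R := K) (M := ↥(M ⊓ S))).1 hinf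
  have hu0' : u ≠ 0 := fun h => hu0 (Subtype.ext h)
  obtain ⟨huM, huS⟩ := Submodule.mem_inf.1 hu
  rw [hS, Submodule.mem_span_range_iff_exists_fun] at huS
  obtain ⟨cf, hcf⟩ := huS
  have hueq : u = cf 0 • (Pi.single j (1 : K) : Fin 4 → K) + cf 1 • Pi.single k 1 := by
    rw [← hcf, Fin.sum_univ_two]; rfl
  have ul : u l = 0 := by
    rw [hueq]; simp [Pi.single_eq_of_ne (Ne.symm hjl), Pi.single_eq_of_ne (Ne.symm hkl)]
  have ul' : u l' = 0 := by
    rw [hueq]; simp [Pi.single_eq_of_ne (Ne.symm hjl'), Pi.single_eq_of_ne (Ne.symm hkl')]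
  have uj : u j = cf 0 := by
    rw [hueq]; simp [Pi.single_eq_of_ne hjk]
  have uk : u k = cf 1 := by
    rw [hueq]; simp [Pi.single_eq_of_ne hjk.symm]
  have e1 := hlev u huM j l l' hjl hjl' hll'
  have e2 := hlev u huM k l l' hkl hkl' hll'
  rw [ul, ul', uj, zero_mul, zero_mul, add_zero, add_zero] at e1
  rw [ul, ul', uk, zero_mul, zero_mul, add_zero, add_zero] at e2
  by_contra hne
  have hα : cf 0 = 0 := (mul_eq_zero.1 e1).resolve_right hne
  have hβ : cf 1 = 0 := (mul_eq_zero.1 e2).resolve_right hne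
  exact hu0' (by rw [hueq, hα, hβ, zero_smul, zero_smul, add_zero])

/-- **Coordinate kernel vectors.**  If the lever identity holds for `u = e_a` and `u = e_b`
(`a ≠ b`), then every `2 × 2` subpermanent of rows `p, p'` on a column pair other than `{a, b}`
vanishes. [folklore] -/
theorem perms_vanish_of_lever_pair (x : Fin 4 × Fin 4 → K) (p p' a b : Fin 4) (hab : a ≠ b)
    (hlev : ∀ u : Fin 4 → K, (u = Pi.single a 1 ∨ u = Pi.single b 1) →
      ∀ j₀ j₁ j₂ : Fin 4, j₀ ≠ j₁ → j₀ ≠ j₂ → j₁ ≠ j₂ →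
      u j₀ * (x (p, j₁) * x (p', j₂) + x (p, j₂) * x (p', j₁)) +
        u j₁ * (x (p, j₀) * x (p', j₂) + x (p, j₂) * x (p', j₀)) +
        u j₂ * (x (p, j₀) * x (p', j₁) + x (p, j₁) * x (p', j₀)) = 0) :
    ∀ l l' : Fin 4, l ≠ l' → ¬(l = a ∧ l' = b) → ¬(l = b ∧ l' = a) →
      x (p, l) * x (p', l') + x (p, l') * x (p', l) = 0 := by
  classical
  intro l l' hll' h1 h2
  -- one of `a, b` is outside `{l, l'}`
  have key : ∀ c : Fin 4, (c = a ∨ c = b) → c ≠ l → c ≠ l' →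
      x (p, l) * x (p', l') + x (p, l') * x (p', l) = 0 := by
    intro c hc hcl hcl'
    have e := hlev (Pi.single c 1) (by rcases hc with hc | hc <;> simp [hc]) c l l' hcl hcl' hll'
    rw [Pi.single_eq_same, Pi.single_eq_of_ne (Ne.symm hcl), Pi.single_eq_of_ne (Ne.symm hcl'),
      one_mul, zero_mul, zero_mul, add_zero, add_zero] at e
    exact e
  by_cases hal : a = l
  · have hbl' : b ≠ l' := fun h => h1 ⟨hal.symm, h.symm⟩
    have hbl : b ≠ l := fun h => hab (hal.trans h.symm)
    exact key b (Or.inr rfl) hbl hbl'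
  by_cases hal' : a = l'
  · have hbl : b ≠ l := fun h => h2 ⟨h.symm, hal'.symm⟩
    have hbl' : b ≠ l' := fun h => hab (hal'.trans h.symm)
    exact key b (Or.inr rfl) hbl hbl'
  exact key a (Or.inl rfl) hal hal'

/-! ### Perm-orthogonality -/

/-- **Two non-zero perm-orthogonal vectors have a common support of size `≤ 2`.**  If
`u_l w_{l'} + u_{l'} w_l = 0` for all `l ≠ l'` and `u, w ≠ 0`, there are `k ≠ l` with
`u_k, w_k ≠ 0`, `u, w` supported on `{k, l}`, and `u_k w_l + u_l w_k = 0`. [folklore] -/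
theorem support_pair_of_perm_orth [CharZero K] (u w : Fin 4 → K) (hu : u ≠ 0) (hw : w ≠ 0)
    (h : ∀ l l' : Fin 4, l ≠ l' → u l * w l' + u l' * w l = 0) :
    ∃ k l : Fin 4, k ≠ l ∧ u k ≠ 0 ∧ w k ≠ 0 ∧ (∀ m, m ≠ k → m ≠ l → u m = 0 ∧ w m = 0) ∧
      u k * w l + u l * w k = 0 := by
  classical
  obtain ⟨k, hk⟩ : ∃ k, u k ≠ 0 := Function.ne_iff.1 hu
  have hwm : ∀ m, m ≠ k → u k * w m = -(u m * w k) := fun m hm => by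
    linear_combination h k m (Ne.symm hm)
  have hwk : w k ≠ 0 := by
    intro h0
    apply hw
    funext m
    by_cases hm : m = k
    · rw [hm, h0]; rfl
    · have := hwm m hm
      rw [h0, mul_zero, neg_zero] at this
      exact (mul_eq_zero.1 this).resolve_left hk
  -- among the indices `≠ k` at most one carries `u`
  have hprod : ∀ m m', m ≠ k → m' ≠ k → m ≠ m' → u m * u m' = 0 := by
    intro m m' hm hm' hmm'
    have e := h m m' hmm'
    have e1 := h k m (Ne.symm hm)
    have e2 := h k m' (Ne.symm hm')
    have h2 : (2 : K) * w k * (u m * u m') = 0 := by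
      linear_combination (-(u k)) * e + u m * e2 + u m' * e1
    rcases mul_eq_zero.1 h2 with h2 | h2
    · exact absurd h2 (mul_ne_zero two_ne_zero hwk)
    · exact h2
  by_cases hex : ∃ m, m ≠ k ∧ u m ≠ 0
  · obtain ⟨l, hlk, hl⟩ := hex
    refine ⟨k, l, hlk.symm, hk, hwk, fun m hmk hml => ?_, h k l hlk.symm⟩
    have hum : u m = 0 := by
      have := hprod l m hlk hmk (Ne.symm hml)
      exact (mul_eq_zero.1 this).resolve_left hl
    refine ⟨hum, ?_⟩
    have := hwm m hmk
    rw [hum, zero_mul, neg_zero] at this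
    exact (mul_eq_zero.1 this).resolve_left hk
  · push Not at hex
    obtain ⟨l, hlk⟩ : ∃ l : Fin 4, l ≠ k := ⟨k + 1, by simp⟩
    refine ⟨k, l, hlk.symm, hk, hwk, fun m hmk _ => ?_, h k l hlk.symm⟩
    have hum : u m = 0 := hex m hmk
    refine ⟨hum, ?_⟩
    have := hwm m hmk
    rw [hum, zero_mul, neg_zero] at this
    exact (mul_eq_zero.1 this).resolve_left hk

/-- **Bilinear perm-orthogonality off one pair forces a coordinate pair.**  If
`x_k y_l + x_l y_k = 0` for all `x ∈ A`, `y ∈ B` and all column pairs `{k, l} ≠ {a, b}`, and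
`dim B ≥ 2`, then `A ⊆ K^{ab}`. (If `x_c ≠ 0`, `y ↦ y_c` is injective on `B`.) [folklore] -/
theorem subset_pair_of_bilinear_perm_orth (A B : Submodule K (Fin 4 → K)) (a b : Fin 4)
    (h : ∀ x ∈ A, ∀ y ∈ B, ∀ k l : Fin 4, k ≠ l → ¬(k = a ∧ l = b) → ¬(k = b ∧ l = a) →
      x k * y l + x l * y k = 0)
    (hB : 2 ≤ finrank K B) : ∀ x ∈ A, ∀ c, c ≠ a → c ≠ b → x c = 0 := by
  intro x hx c hca hcb
  by_contra hxc
  -- `y ↦ y c` is injective on `B`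
  let π : (Fin 4 → K) →ₗ[K] K := LinearMap.proj c
  have hinj : Function.Injective (π.domRestrict B) := by
    intro y₁ y₂ hyy
    apply Subtype.ext
    have hsub : ((y₁ : Fin 4 → K) - y₂) ∈ B := B.sub_mem y₁.2 y₂.2
    have hc0 : ((y₁ : Fin 4 → K) - y₂) c = 0 := by
      have : π y₁ = π y₂ := hyy
      simp only [π, LinearMap.proj_apply] at this
      rw [Pi.sub_apply, this, sub_self]
    have hall : ∀ m, ((y₁ : Fin 4 → K) - y₂) m = 0 := by
      intro m
      by_cases hmc : m = c
      · rw [hmc]; exact hc0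
      have e := h x hx _ hsub c m (Ne.symm hmc) (fun hh => hca hh.1) (fun hh => hcb hh.1)
      rw [hc0, mul_zero, add_zero] at e
      exact (mul_eq_zero.1 e).resolve_left hxc
    exact sub_eq_zero.1 (funext hall)
  have hle := LinearMap.finrank_le_finrank_of_injective hinj
  rw [Module.finrank_self] at hle
  omega

/-- **Full bilinear perm-orthogonality against a `2`-dimensional space is trivial.** [folklore] -/
theorem eq_zero_of_bilinear_perm_orth (A B : Submodule K (Fin 4 → K))
    (h : ∀ x ∈ A, ∀ y ∈ B, ∀ k l : Fin 4, k ≠ l → x k * y l + x l * y k = 0)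
    (hB : 2 ≤ finrank K B) : ∀ x ∈ A, x = 0 := by
  intro x hx
  have h01 := subset_pair_of_bilinear_perm_orth A B 0 1
    (fun x hx y hy k l hkl _ _ => h x hx y hy k l hkl) hB x hx
  have h23 := subset_pair_of_bilinear_perm_orth A B 2 3
    (fun x hx y hy k l hkl _ _ => h x hx y hy k l hkl) hB x hx
  funext m
  fin_cases m
  · exact h23 0 (by decide) (by decide)
  · exact h23 1 (by decide) (by decide)
  · exact h01 2 (by decide) (by decide)
  · exact h01 3 (by decide) (by decide)

/-- **A `2`-dimensional subspace of `K^{ab}` is all of `K^{ab}`.** [folklore] -/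
theorem mem_of_le_pair_of_finrank (A : Submodule K (Fin 4 → K)) (a b : Fin 4)
    (hle : ∀ x ∈ A, ∀ c, c ≠ a → c ≠ b → x c = 0) (h2 : 2 ≤ finrank K A)
    (v : Fin 4 → K) (hv : ∀ c, c ≠ a → c ≠ b → v c = 0) : v ∈ A := by
  classical
  -- the map `x ↦ (x a, x b)` is injective on `A`, hence onto `K²`
  let f : (Fin 4 → K) →ₗ[K] (Fin 2 → K) := LinearMap.pi fun i => LinearMap.proj (![a, b] i)
  have hf : ∀ x i, f x i = x (![a, b] i) := fun _ _ => rfl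
  have hinj : Function.Injective (f.domRestrict A) := by
    intro x₁ x₂ hxx
    apply Subtype.ext
    funext c
    have hsub : ((x₁ : Fin 4 → K) - x₂) ∈ A := A.sub_mem x₁.2 x₂.2
    by_cases hca : c = a
    · have := congr_fun hxx 0
      simp only [LinearMap.domRestrict_apply, hf, Matrix.cons_val_zero] at this
      rw [hca]; exact this
    by_cases hcb : c = b
    · have := congr_fun hxx 1
      simp only [LinearMap.domRestrict_apply, hf, Matrix.cons_val_one, Matrix.cons_val_zero] at this
      rw [hcb]; exact this
    exact sub_eq_zero.1 (by have := hle _ hsub c hca hcb; rwa [Pi.sub_apply] at this)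
  have hsurj : Function.Surjective (f.domRestrict A) := by
    have hr := LinearMap.finrank_range_add_finrank_ker (f.domRestrict A)
    rw [LinearMap.ker_eq_bot.2 hinj, finrank_bot, add_zero] at hr
    have htop : LinearMap.range (f.domRestrict A) = ⊤ := by
      apply Submodule.eq_top_of_finrank_eq
      rw [hr, Module.finrank_fintype_fun_eq_card, Fintype.card_fin]
      have := LinearMap.finrank_le_finrank_of_injective hinj
      rw [Module.finrank_fintype_fun_eq_card, Fintype.card_fin] at this
      omega
    exact LinearMap.range_eq_top.1 htop
  obtain ⟨⟨x, hxA⟩, hx⟩ := hsurj (fun i => v (![a, b] i))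
  have hxv : x = v := by
    funext c
    by_cases hca : c = a
    · have := congr_fun hx 0
      simp only [LinearMap.domRestrict_apply, hf, Matrix.cons_val_zero] at this
      rw [hca]; exact this
    by_cases hcb : c = b
    · have := congr_fun hx 1
      simp only [LinearMap.domRestrict_apply, hf, Matrix.cons_val_one, Matrix.cons_val_zero] at this
      rw [hcb]; exact this
    rw [hle x hxA c hca hcb, hv c hca hcb]
  rw [← hxv]; exact hxA

end Summit.ValiantsHypothesis.ValiantsHypothesis.Theorems.SymPencilPerFourToricLever

end
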